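import Summits.CriticalPhenomena.PercolationContinuityZ3.Theorems.SahiMasterFamilyChangeWeightBound
import Summits.CriticalPhenomena.PercolationContinuityZ3.Theorems.SahiMasterFamilyEqImpliesNonneg
import Summits.CriticalPhenomena.PercolationContinuityZ3.Theorems.SahiMasterFamilyEqPrincipal
import Literature.Combinatorics.Sahi2008.IndependentSplitting

/-!
# Principal-slot domination `E_{k+2}(P, U) ≥ [P(U_i | P) − P(U_i)]·E_{k+1}(P, U_{−i})`, heredity of zeros, and
# (EQ-(k+2)) ⇒ (EQ-(k+3)) on the principal stratum — every `k`

Companion of `SahiMasterFamily.lean`, `SahiMasterFamilyHeredity.lean`, `SahiMasterFamilyEqPrincipal.lean` (crux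
`NoHeavyLowerTail`, stmt-CriticalPhenomena-4575; cell `prim-masterthm`, unit `prim-masterthm-p4` = "induction on `k` through
the FKG-lattice structure + the equality locus").  Vocabulary as there: Sahi's `E_k` = `Literature.Combinatorics.Sahi2008.sahiE`
[Sahi2008; LiebSahi2021, Def. 3.1 / Prop. 3.3], product weight `bernoulliWeight p` on `Set ι`, indicators `ind`,
`MasterFamilyNonneg k` (= Sahi's `C_k` on product measures [Kahn2022, Conj. 5 at `k = 3`]; OPEN for `k ≥ 3`),
`MasterFamilyEqIff k` (our conjectured zero locus `Z_k = SuppZeroFlag k`; OPEN for `k ≥ 3`; it contains `MasterFamilyNonneg k`,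
`masterFamilyNonneg_of_masterFamilyEqIff`).  "Principal stratum" = families one of whose events is a cylinder
`P = {ω | S ⊆ ω}` (all coordinates of `S` open); `p'` = `p` with the coordinates of `S` frozen to `1`, so that
`P_{p'}(A) = P_p(A | P)` and `P_{p'}(A) − P_p(A) = Cov_p(1_A, 1_P)/P_p(P) ≥ 0` (Harris), `= 0` iff `A ⟂ P`.

RESULTS (every `k`; the abstract series inequality is `SahiMasterFamilyChangeWeightBound.sahiE_cons_setInd_ge_erase`):
* `sahiE_ind_cylinder_ge_erase` — **PRINCIPAL-SLOT DOMINATION**: GIVEN `MasterFamilyNonneg (k+1)`, for increasing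
  `U_0,…,U_k`, every `p ∈ [0,1]^ι` and every slot `i`,
      `E_{k+2}(μ_p; 1_P, 1_{U_0},…,1_{U_k}) ≥ [P_{p'}(U_i) − P_p(U_i)] · E_{k+1}(μ_p; 1_P, 1_{U_{−i}})`;
  unconditional at `k + 1 = 2`: `E_3(P, A, B) ≥ [P(B|P) − P(B)]·Cov(P, A)` (`sahiE_three_ind_cylinder_ge`; Blinovsky's
  chain gives the same with the roles of the three nonnegative brackets explicit).  Exact numerics (unit folder
  `code/domtest*.py`): 76 200 random instances on `{0,1}^3`, `{0,1}^4`, orders `3, 4, 5`, 0 violations, ratio `= 1` attained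
  at orders 3 and 4.  The analogue with an ARBITRARY increasing event `V` in place of the cylinder is FALSE
  (`A = x_1, B = x_2, V = x_1 ∨ x_2`: `E_3 = 0 < [P(B|V) − P(B)]·Cov(V, A)`), consistent with the failure of every slot-wise
  sharing rule off the principal class (unit notes MASTER-ROUTES §P4.2).
* `sahiE_ind_cylinder_heredity` — **HEREDITY OF ZEROS ON THE PRINCIPAL STRATUM**: GIVEN `MasterFamilyNonneg (k+2)`, for
  `p` in the open cube, if `E_{k+3}(μ_p; 1_P, 1_{U_1},…,1_{U_{k+2}}) = 0` then `E_{k+2}` vanishes on SOME deleted family: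
  at any slot `U_i` correlated with `P` (domination), or — if every `U_i ⟂ P`, whence (strict Harris,
  `disjoint_determinedBy_of_real_inter_eq`) every `U_i` is determined off `S` — at the slot of `P` itself, by independent
  splitting `E_{k+3}(1_P, 1_U) = (k+1)·P(P)·E_{k+2}(1_U)` [LiebSahi2021, Prop. 3.4] (`sahiE_bernoulliWeight_ind_cons_eq_of_determinedBy`).
* `sahiE_ind_eq_zero_iff_of_cylinder_head` — **(EQ-(k+2)) ⇒ (EQ-(k+3)) ON THE PRINCIPAL STRATUM**: GIVEN
  `MasterFamilyEqIff (k+2)`, for `p` interior and `k + 3` increasing events with a cylinder in slot `0`,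
  `E_{k+3}(μ_p; 1_U) = 0 ↔ U ∈ Z_{k+3}` (heredity + the peeled step `masterFamily_step`); cylinder in ANY slot:
  `sahiE_ind_eq_zero_iff_of_cylinder` (via the symmetry of `E_n` and `exists_perm_succAbove_comp`).  Unconditional at order 3
  (`sahiE_three_ind_eq_zero_iff_of_cylinder'`, = the cell's `sahiE_three_ind_eq_zero_iff_of_cylinder` for any slot), and at
  order 4 conditional on `MasterFamilyEqIff 3` alone (`sahiE_four_ind_eq_zero_iff_of_cylinder`).
So on the principal stratum BOTH halves of the master statement are hereditary in `k`: positivity by Blinovsky's identity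
(tree, `sahiE_bernoulliWeight_ind_nonneg_offK`), the zero locus by the domination inequality of this file.  Together with the
comparable stratum (`SahiMasterFamilyComparableStep`) and the independent/zero-flag stratum (`SahiMasterFamilyHeredity`) the
`k → k+1` step of (M-k) ∧ (EQ-k) is proved off the residual class of antichains of pairwise-dependent non-principal events.
HONEST FRAMING: nothing here asserts `C_k` or (EQ-k) for `k ≥ 3`. [this work]
-/

set_option autoImplicit false

open Finset
open scoped Classical

open private sum_cond_sub_mul_prod_nonneg from Literature.Combinatorics.Sahi2008.FKGCumulation

namespace Summit.CriticalPhenomena.PercolationContinuityZ3.Theorems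

open Literature.Combinatorics.Sahi2008

/-! ### Events under a product measure: the principal stratum -/

section Events

open MeasureTheory Function
open Literature.Probability.LatticeModels (principalUp mem_principalUp isUpperSet_principalUp prodBernoulli)
open Literature.Probability.Percolation (DeterminedBy determinedBy_iff)
open Literature.Probability.Percolation.DecisionTree (ind ind_of_mem ind_of_not_mem ind_nonneg)

variable {ι : Type} [Fintype ι]

/-- The indicator of the principal up-set `{ω | S ⊆ ω}` of the lattice `Set ι` is the cylinder indicator. [folklore] -/
theorem setInd_principalUp_eq_ind (S : Set ι) : setInd (principalUp S) = ind {ω : Set ι | S ⊆ ω} := by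
  funext ω
  rw [setInd_apply]
  by_cases h : S ⊆ ω
  · rw [if_pos (mem_principalUp.2 h), ind_of_mem (show ω ∈ {ω : Set ι | S ⊆ ω} from h)]
  · rw [if_neg (fun h' => h (mem_principalUp.1 h')), ind_of_not_mem (show ω ∉ {ω : Set ι | S ⊆ ω} from h)]

/-- The conditioning identity for the product weight and the cylinder `{S ⊆ ω}`: `m·w_{p'} = 1_{S ⊆ ω}·w_p` with
`m = ∏_{e∈S} p_e` and `p'` = `p` with the coordinates of `S` frozen to `1`. [cite: Sahi2008, eq. (2) (p. 210)] -/
theorem freeze_mul_bernoulliWeight_eq (p : ι → unitInterval) (S : Set ι) (ω : Set ι) :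
    (∏ e, if e ∈ S then (p e : ℝ) else 1) * bernoulliWeight (fun e => if e ∈ S then 1 else p e) ω =
      if ω ∈ principalUp S then bernoulliWeight p ω else 0 := by
  classical
  rw [← ite_le_bernoulliWeight_eq p S ω]
  simp only [mem_principalUp]

/-- `E_{p'}(1_A) − E_p(1_A) ≥ 0` for an increasing event `A` (`p'` = `p` frozen to `1` on `S`): Harris' inequality
for `A` and the cylinder, in conditional form. [cite: Harris1960, Lemma 4.1] -/
theorem sum_freeze_sub_mul_prod_ind_nonneg (p : ι → unitInterval) (S : Set ι)
    (hm : 0 < ∏ e, if e ∈ S then (p e : ℝ) else 1) {k : ℕ} {U : Fin k → Set (Set ι)}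
    (hU : ∀ j, IsUpperSet (U j)) (ρ : Finset (Fin k)) :
    0 ≤ ∑ ω, (bernoulliWeight (fun e => if e ∈ S then 1 else p e) ω - bernoulliWeight p ω) *
      ∏ i ∈ ρ, ind (U i) ω := by
  classical
  have hsum : ∑ ω ∈ principalUp S, bernoulliWeight p ω = ∏ e, if e ∈ S then (p e : ℝ) else 1 :=
    sum_principalUp_bernoulliWeight p S
  have hmpos : 0 < ∑ ω ∈ principalUp S, bernoulliWeight p ω := by rw [hsum]; exact hm
  have h := sum_cond_sub_mul_prod_nonneg (isFKGMeasure_bernoulliWeight p) S hmpos (g := fun l => ind (U l))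
    (fun l ω => ind_nonneg _ _) (fun l => monotone_ind_of_isUpperSet (hU l)) ρ
  have hcond := bernoulliWeight_cond_principalUp p S hmpos
  refine le_of_le_of_eq h (Finset.sum_congr rfl fun ω _ => ?_)
  rw [show (if S ≤ ω then bernoulliWeight p ω else 0) / (∑ ω ∈ principalUp S, bernoulliWeight p ω) =
    bernoulliWeight (fun e => if e ∈ S then 1 else p e) ω from congrFun hcond ω]

/-- **Principal-slot domination for increasing events under a product measure (every `k`).**  GIVEN
`MasterFamilyNonneg (k+1)` (Sahi's `C_{k+1}` on product measures; a theorem for `k + 1 ≤ 2`), for the cylinder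
`P = {ω | S ⊆ ω}`, increasing events `U_0,…,U_k` and every slot `i`:
`E_{k+2}(μ_p; 1_P, 1_{U_0},…,1_{U_k}) ≥ [P_{p'}(U_i) − P_p(U_i)] · E_{k+1}(μ_p; 1_P, 1_{U_{−i}})`,
where `p'` is `p` with the coordinates of `S` frozen to `1` (so `P_{p'}(U_i) = P_p(U_i | P)` when `P_p(P) > 0`, and the
bracket is `Cov_p(U_i, P)/P_p(P) ≥ 0`).  Hence a zero of `E_{k+2}` on the principal stratum forces a zero of `E_{k+1}`
at every slot whose event is correlated with the cylinder (`sahiE_ind_cylinder_heredity`). [this work] -/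
theorem sahiE_ind_cylinder_ge_erase {k : ℕ} (hN : MasterFamilyNonneg (k + 1)) (p : ι → unitInterval)
    (S : Set ι) (U : Fin (k + 1) → Set (Set ι)) (hU : ∀ j, IsUpperSet (U j)) (i : Fin (k + 1)) :
    (ex (bernoulliWeight fun e => if e ∈ S then 1 else p e) (ind (U i)) - ex (bernoulliWeight p) (ind (U i))) *
        sahiE (bernoulliWeight p) (k + 1)
          (Matrix.vecCons (ind {ω : Set ι | S ⊆ ω}) fun l => ind (U (i.succAbove l))) ≤
      sahiE (bernoulliWeight p) (k + 2) (Matrix.vecCons (ind {ω : Set ι | S ⊆ ω}) fun l => ind (U l)) := by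
  classical
  set p' : ι → unitInterval := fun e => if e ∈ S then 1 else p e with hp'_def
  set m : ℝ := ∏ e, if e ∈ S then (p e : ℝ) else 1 with hm_def
  have hm0 : 0 ≤ m := Finset.prod_nonneg fun e _ => by
    split_ifs
    · exact (p e).2.1
    · exact zero_le_one
  have hμ' : ∀ ω, m * bernoulliWeight p' ω = if ω ∈ principalUp S then bernoulliWeight p ω else 0 :=
    fun ω => freeze_mul_bernoulliWeight_eq p S ω
  rw [← setInd_principalUp_eq_ind S]
  rcases hm0.eq_or_lt with hm | hm
  · -- `P(P) = 0`: both functionals vanish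
    have hnull : ∀ ω ∈ principalUp S, bernoulliWeight p ω = 0 := fun ω hω => by
      have h := hμ' ω
      rw [if_pos hω, ← hm, zero_mul] at h
      exact h.symm
    rw [sahiE_cons_setInd_eq_zero_of_null _ (sum_bernoulliWeight p) _ hnull,
      sahiE_cons_setInd_eq_zero_of_null _ (sum_bernoulliWeight p) _ hnull, mul_zero]
  · have H : ∀ ρ : Finset (Fin (k + 1)),
        0 ≤ ∑ ω, (bernoulliWeight p' ω - bernoulliWeight p ω) * ∏ i ∈ ρ, ind (U i) ω :=
      fun ρ => sum_freeze_sub_mul_prod_ind_nonneg p S hm hU ρ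
    have hq : ∀ (j : ℕ) (e : Fin j ↪ Fin (k + 1)),
        0 ≤ sahiE (bernoulliWeight p') (j + 1) (Matrix.vecCons 1 fun l => ind (U (e l))) := by
      intro j e
      cases j with
      | zero =>
        rw [sahiE_one_apply, Matrix.cons_val_zero, ex_one (sum_bernoulliWeight p')]
        exact zero_le_one
      | succ j =>
        rw [sahiE_one_cons (sum_bernoulliWeight p')]
        have hle : j + 1 ≤ k + 1 := by simpa using Fintype.card_le_of_embedding e
        exact mul_nonneg (Nat.cast_nonneg _)
          (masterFamilyNonneg_antitone hle hN ι p' (fun l => U (e l)) fun l => hU _)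
    have hδ : ∑ ω, (bernoulliWeight p' ω - bernoulliWeight p ω) * ind (U i) ω =
        ex (bernoulliWeight p') (ind (U i)) - ex (bernoulliWeight p) (ind (U i)) := by
      rw [ex, ex, ← Finset.sum_sub_distrib]
      exact Finset.sum_congr rfl fun ω _ => by ring
    have h := sahiE_cons_setInd_ge_erase (bernoulliWeight p) (sum_bernoulliWeight p) (bernoulliWeight p')
      (sum_bernoulliWeight p') (principalUp S) m hm.le hμ' (fun l => ind (U l)) H hq i
    rwa [hδ] at h

omit [Fintype ι] in
/-- The family `(1_{U_j})_j` as `vecCons` of its head. [folklore] -/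
theorem ind_family_eq_vecCons {n : ℕ} (U : Fin (n + 1) → Set (Set ι)) :
    (fun j => ind (U j)) = Matrix.vecCons (ind (U 0)) fun l => ind (U l.succ) := by
  funext j
  refine Fin.cases ?_ (fun l => ?_) j
  · simp
  · simp

omit [Fintype ι] in
/-- Deleting slot `i.succ` of a family keeps the head. [folklore] -/
theorem ind_family_succAbove_succ_eq_vecCons {n : ℕ} (U : Fin (n + 2) → Set (Set ι)) (i : Fin (n + 1)) :
    (fun j => ind (U (i.succ.succAbove j))) = Matrix.vecCons (ind (U 0)) fun l => ind (U (i.succAbove l).succ) := by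
  funext j
  refine Fin.cases ?_ (fun l => ?_) j
  · simp
  · simp [Fin.succ_succAbove_succ]

/-- Every configuration, in particular `univ`, has positive weight in the open cube; so `P(S ⊆ ω) > 0`. [folklore] -/
theorem ex_ind_cylinder_pos {p : ι → unitInterval} (hp : ∀ e, (p e : ℝ) ∈ Set.Ioo (0 : ℝ) 1) (S : Set ι) :
    0 < ex (bernoulliWeight p) (ind {ω : Set ι | S ⊆ ω}) := by
  rw [ex]
  refine lt_of_lt_of_le ?_ (Finset.single_le_sum (f := fun ω => bernoulliWeight p ω * ind {ω : Set ι | S ⊆ ω} ω)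
    (fun ω _ => mul_nonneg (bernoulliWeight_pos hp ω).le (ind_nonneg _ _)) (Finset.mem_univ Set.univ))
  rw [ind_of_mem (show (Set.univ : Set ι) ∈ {ω : Set ι | S ⊆ ω} from Set.subset_univ S), mul_one]
  exact bernoulliWeight_pos hp _

omit [Fintype ι] in
/-- A cylinder `{ω | S ⊆ ω}` determined by `T` has `S ⊆ T` (compare `univ` with `univ ∖ {e}`). [folklore] -/
theorem subset_of_determinedBy_cylinder {S T : Set ι} (h : DeterminedBy {ω : Set ι | S ⊆ ω} T) : S ⊆ T := by
  intro e he
  by_contra heT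
  have h1 := (determinedBy_iff _ T).1 h Set.univ (Set.univ \ {e}) (by
    ext x
    simp only [Set.mem_inter_iff, Set.mem_univ, true_and, Set.mem_sdiff, Set.mem_singleton_iff, iff_and_self]
    intro hx hxe
    exact heT (hxe ▸ hx))
  have h2 : (Set.univ \ {e} : Set ι) ∈ {ω : Set ι | S ⊆ ω} := h1.1 (Set.subset_univ S)
  exact (h2 he).2 rfl

omit [Fintype ι] in
/-- The cylinder `{ω | S ⊆ ω}` is determined by `S`. [folklore] -/
theorem determinedBy_cylinder (S : Set ι) : DeterminedBy {ω : Set ι | S ⊆ ω} S := by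
  refine (determinedBy_iff _ S).2 fun ω ω' hωω' => ?_
  show S ⊆ ω ↔ S ⊆ ω'
  rw [← Set.inter_eq_right, ← Set.inter_eq_right, hωω']

/-- **Heredity of zeros on the principal stratum (every `k`).**  GIVEN `MasterFamilyNonneg (k+2)`, for `p` in the open
cube and `k + 3` increasing events with `U_0 = {ω | S ⊆ ω}` a cylinder: if `E_{k+3}(μ_p; 1_U) = 0` then
`E_{k+2}(μ_p; 1_{U_{−m}}) = 0` for some slot `m` — namely any slot `m = i + 1` whose event is correlated with the cylinder
(domination), or `m = 0` when every `U_{i+1}` is independent of it (then, by strict Harris, all `U_{i+1}` are determined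
off `S` and `E_{k+3}(1_P, 1_U) = (k+1)·P(P)·E_{k+2}(1_U)` by independent splitting). [this work] -/
theorem sahiE_ind_cylinder_heredity {k : ℕ} (hN : MasterFamilyNonneg (k + 2)) (p : ι → unitInterval)
    (hp : ∀ e, (p e : ℝ) ∈ Set.Ioo (0 : ℝ) 1) (S : Set ι) (U : Fin (k + 3) → Set (Set ι))
    (hU0 : U 0 = {ω : Set ι | S ⊆ ω}) (hU : ∀ j, IsUpperSet (U j))
    (h0 : sahiE (bernoulliWeight p) (k + 3) (fun j => ind (U j)) = 0) :
    ∃ m : Fin (k + 3), sahiE (bernoulliWeight p) (k + 2) (fun j => ind (U (m.succAbove j))) = 0 := by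
  classical
  set p' : ι → unitInterval := fun e => if e ∈ S then 1 else p e with hp'_def
  by_cases hex : ∃ i : Fin (k + 2),
      ex (bernoulliWeight p') (ind (U i.succ)) - ex (bernoulliWeight p) (ind (U i.succ)) ≠ 0
  · -- a slot correlated with the cylinder: domination
    obtain ⟨i, hi⟩ := hex
    have hm : 0 < ∏ e, if e ∈ S then (p e : ℝ) else 1 :=
      Finset.prod_pos fun e _ => by
        split_ifs
        · exact (hp e).1
        · exact zero_lt_one
    have hδ0 : 0 ≤ ex (bernoulliWeight p') (ind (U i.succ)) - ex (bernoulliWeight p) (ind (U i.succ)) := by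
      have h := sum_freeze_sub_mul_prod_ind_nonneg p S hm (U := fun l : Fin (k + 2) => U l.succ)
        (fun l => hU _) {i}
      rw [ex, ex, ← Finset.sum_sub_distrib]
      refine le_of_le_of_eq h (Finset.sum_congr rfl fun ω _ => ?_)
      rw [Finset.prod_singleton]; ring
    have hδ : 0 < ex (bernoulliWeight p') (ind (U i.succ)) - ex (bernoulliWeight p) (ind (U i.succ)) :=
      lt_of_le_of_ne hδ0 (Ne.symm hi)
    have hdom := sahiE_ind_cylinder_ge_erase hN p S (fun l : Fin (k + 2) => U l.succ) (fun l => hU _) i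
    rw [← hU0, ← ind_family_eq_vecCons U, h0, ← ind_family_succAbove_succ_eq_vecCons U i] at hdom
    have hnn : 0 ≤ sahiE (bernoulliWeight p) (k + 2) (fun j => ind (U (i.succ.succAbove j))) :=
      hN ι p _ fun j => hU _
    exact ⟨i.succ, le_antisymm (le_of_mul_le_mul_left (by rw [mul_zero]; exact hdom) hδ) hnn⟩
  · -- every `U_{i+1}` independent of the cylinder: strict Harris and independent splitting
    push Not at hex
    have hm : 0 < ∏ e, if e ∈ S then (p e : ℝ) else 1 :=
      Finset.prod_pos fun e _ => by
        split_ifs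
        · exact (hp e).1
        · exact zero_lt_one
    set F : Finset ι := univ.filter (· ∈ S) with hF_def
    have hF : (↑F : Set ι) = S := by ext e; simp [hF_def]
    have hdet : ∀ l : Fin (k + 2), DeterminedBy (U l.succ) (↑F : Set ι)ᶜ := by
      intro l
      -- independence `P(U ∩ P) = P(U) P(P)` from `δ = 0`
      have hind : ex (bernoulliWeight p) (ind (U l.succ) * ind {ω : Set ι | S ⊆ ω}) =
          ex (bernoulliWeight p) (ind (U l.succ)) * ex (bernoulliWeight p) (ind {ω : Set ι | S ⊆ ω}) := by
        have hPm : ex (bernoulliWeight p) (ind {ω : Set ι | S ⊆ ω}) = ∏ e, if e ∈ S then (p e : ℝ) else 1 := by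
          rw [← setInd_principalUp_eq_ind, ex_setInd]
          exact sum_principalUp_bernoulliWeight p S
        have h1 : ex (bernoulliWeight p) (ind (U l.succ) * ind {ω : Set ι | S ⊆ ω}) =
            (∏ e, if e ∈ S then (p e : ℝ) else 1) * ex (bernoulliWeight p') (ind (U l.succ)) := by
          rw [ex, ex, Finset.mul_sum]
          refine Finset.sum_congr rfl fun ω _ => ?_
          have hfr := freeze_mul_bernoulliWeight_eq p S ω
          rw [← setInd_principalUp_eq_ind, Pi.mul_apply, setInd_apply]
          calc bernoulliWeight p ω * (ind (U l.succ) ω * if ω ∈ principalUp S then 1 else 0)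
              = (if ω ∈ principalUp S then bernoulliWeight p ω else 0) * ind (U l.succ) ω := by
                split_ifs <;> ring
            _ = (∏ e, if e ∈ S then (p e : ℝ) else 1) * (bernoulliWeight p' ω * ind (U l.succ) ω) := by
                rw [← hfr]; ring
        rw [h1, hPm, sub_eq_zero.1 (hex l), mul_comm]
      obtain ⟨SA, T, hST, hSA, hT⟩ := disjoint_determinedBy_of_real_inter_eq p hp (hU l.succ)
        (isUpperSet_cylinder S) hind
      have hSsub : S ⊆ ↑T := subset_of_determinedBy_cylinder hT
      refine hSA.mono fun e he => ?_
      rw [hF, Set.mem_compl_iff]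
      intro heS
      exact Finset.disjoint_left.1 hST he (hSsub heS)
    have hsplit := sahiE_bernoulliWeight_ind_cons_eq_of_determinedBy p F
      (show DeterminedBy {ω : Set ι | S ⊆ ω} (↑F : Set ι) from hF ▸ determinedBy_cylinder S)
      (fun l : Fin (k + 2) => U l.succ) hdet
    rw [← hU0, ← ind_family_eq_vecCons U, h0] at hsplit
    have hPpos : 0 < (prodBernoulli p).real (U 0) := by
      rw [← ex_bernoulliWeight_ind, hU0]; exact ex_ind_cylinder_pos hp S
    have hk : (0 : ℝ) < (k + 1 : ℕ) := by positivity
    refine ⟨0, ?_⟩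
    have h := hsplit.symm
    rw [mul_eq_zero, mul_eq_zero] at h
    rcases h with (h | h) | h
    · exact absurd h hk.ne'
    · exact absurd h hPpos.ne'
    · simpa [Fin.succAbove_zero] using h

/-- **(EQ-(k+2)) ⇒ (EQ-(k+3)) on the principal stratum (every `k`).**  GIVEN `MasterFamilyEqIff (k+2)` (which
contains `MasterFamilyNonneg (k+2)`, `masterFamilyNonneg_of_masterFamilyEqIff`), for `p` in the open cube and `k + 3`
increasing events one of which (placed in slot `0`; `E` and `Z` are symmetric) is a cylinder `{ω | S ⊆ ω}`:
`E_{k+3}(μ_p; 1_U) = 0 ↔ U ∈ Z_{k+3}`.  Heredity (`sahiE_ind_cylinder_heredity`) + the peeled step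
(`masterFamily_step`). [this work] -/
theorem sahiE_ind_eq_zero_iff_of_cylinder_head {k : ℕ} (hE : MasterFamilyEqIff (k + 2)) (p : ι → unitInterval)
    (hp : ∀ e, (p e : ℝ) ∈ Set.Ioo (0 : ℝ) 1) (S : Set ι) (U : Fin (k + 3) → Set (Set ι))
    (hU0 : U 0 = {ω : Set ι | S ⊆ ω}) (hU : ∀ j, IsUpperSet (U j)) :
    sahiE (bernoulliWeight p) (k + 3) (fun j => ind (U j)) = 0 ↔ SuppZeroFlag (k + 3) U := by
  have hN : MasterFamilyNonneg (k + 2) := masterFamilyNonneg_of_masterFamilyEqIff hE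
  refine ⟨fun h => ?_, fun h => masterFamilyEqIff_mpr (k + 3) ι p U h⟩
  obtain ⟨m, hm⟩ := sahiE_ind_cylinder_heredity hN p hp S U hU0 hU h
  have hZ : SuppZeroFlag (k + 2) (fun j => U (m.succAbove j)) := (hE ι p hp _ fun j => hU _).1 hm
  exact (masterFamily_step hN hE p hp U hU m hZ).2.1 h

/-- **Unconditional heredity at order 3 / domination at order 3**: for a cylinder `P`, increasing `A, B` and every
`p ∈ [0,1]^ι`, `E_3(1_P, 1_A, 1_B) ≥ [P_{p'}(B) − P_p(B)]·Cov_p(1_P, 1_A)` (the step at `MasterFamilyNonneg 2` = Harris).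
[this work] -/
theorem sahiE_three_ind_cylinder_ge (p : ι → unitInterval) (S : Set ι) (A B : Set (Set ι)) (hA : IsUpperSet A)
    (hB : IsUpperSet B) :
    (ex (bernoulliWeight fun e => if e ∈ S then 1 else p e) (ind B) - ex (bernoulliWeight p) (ind B)) *
        sahiE (bernoulliWeight p) 2 ![ind {ω : Set ι | S ⊆ ω}, ind A] ≤
      sahiE (bernoulliWeight p) 3 ![ind {ω : Set ι | S ⊆ ω}, ind A, ind B] := by
  have h := sahiE_ind_cylinder_ge_erase (masterFamilyNonneg_of_le_two le_rfl) p S ![A, B]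
    (fun j => by fin_cases j <;> assumption) 1
  have e1 : (Matrix.vecCons (ind {ω : Set ι | S ⊆ ω}) fun l => ind ((![A, B] : Fin 2 → Set (Set ι)) ((1 : Fin 2).succAbove l)))
      = ![ind {ω : Set ι | S ⊆ ω}, ind A] := by
    funext j; fin_cases j <;> rfl
  have e2 : (Matrix.vecCons (ind {ω : Set ι | S ⊆ ω}) fun l => ind ((![A, B] : Fin 2 → Set (Set ι)) l))
      = ![ind {ω : Set ι | S ⊆ ω}, ind A, ind B] := by
    funext j; fin_cases j <;> rfl
  rw [e1, e2] at h
  exact h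

/-! ### The cylinder in an arbitrary slot -/

omit [Fintype ι] in
/-- `E_k` of a permuted event family. [cite: LiebSahi2021, Def. 3.1 (symmetry of `E_n`)] -/
theorem sahiE_ind_comp_perm [Fintype ι] (μ : Set ι → ℝ) {n : ℕ} (σ : Equiv.Perm (Fin n)) (U : Fin n → Set (Set ι)) :
    sahiE μ n (fun j => ind (U (σ j))) = sahiE μ n (fun j => ind (U j)) :=
  sahiE_comp_perm μ n σ (fun j => ind (U j))

/-- Conjugating a deleted-slot enumeration by a permutation: `σ ∘ m'.succAbove = (σ m').succAbove ∘ τ` for a permutation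
`τ` of the remaining slots. [folklore] -/
theorem exists_perm_succAbove_comp {n : ℕ} (σ : Equiv.Perm (Fin (n + 1))) (m' : Fin (n + 1)) :
    ∃ τ : Equiv.Perm (Fin n), ∀ j, σ (m'.succAbove j) = (σ m').succAbove (τ j) := by
  have hex : ∀ j : Fin n, ∃ t : Fin n, (σ m').succAbove t = σ (m'.succAbove j) := fun j =>
    Fin.exists_succAbove_eq (fun h => Fin.succAbove_ne m' j (σ.injective h))
  choose τ hτ using hex
  have hinj : Function.Injective τ := fun j j' h => by
    have := hτ j
    rw [h, hτ j'] at this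
    exact Fin.succAbove_right_injective (σ.injective this.symm)
  refine ⟨Equiv.ofBijective τ (Finite.injective_iff_bijective.1 hinj), fun j => ?_⟩
  rw [Equiv.ofBijective_apply, hτ j]

/-- **Heredity on the principal stratum, cylinder in any slot**: GIVEN `MasterFamilyNonneg (k+2)`, `p` interior,
`k + 3` increasing events one of which is a cylinder, `E_{k+3}(μ_p; 1_U) = 0 ⇒ ∃ m, E_{k+2}(μ_p; 1_{U_{−m}}) = 0`.
[this work] -/
theorem sahiE_ind_cylinder_heredity' {k : ℕ} (hN : MasterFamilyNonneg (k + 2)) (p : ι → unitInterval)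
    (hp : ∀ e, (p e : ℝ) ∈ Set.Ioo (0 : ℝ) 1) (U : Fin (k + 3) → Set (Set ι)) (hU : ∀ j, IsUpperSet (U j))
    (m₀ : Fin (k + 3)) (S : Set ι) (hm₀ : U m₀ = {ω : Set ι | S ⊆ ω})
    (h0 : sahiE (bernoulliWeight p) (k + 3) (fun j => ind (U j)) = 0) :
    ∃ m : Fin (k + 3), sahiE (bernoulliWeight p) (k + 2) (fun j => ind (U (m.succAbove j))) = 0 := by
  set σ : Equiv.Perm (Fin (k + 3)) := Equiv.swap 0 m₀ with hσ_def
  have h0' : sahiE (bernoulliWeight p) (k + 3) (fun j => ind (U (σ j))) = 0 := by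
    rw [sahiE_ind_comp_perm]; exact h0
  have hσ0 : U (σ 0) = {ω : Set ι | S ⊆ ω} := by
    rw [hσ_def, Equiv.swap_apply_left]; exact hm₀
  obtain ⟨m', hm'⟩ := sahiE_ind_cylinder_heredity hN p hp S (fun j => U (σ j)) hσ0 (fun j => hU _) h0'
  obtain ⟨τ, hτ⟩ := exists_perm_succAbove_comp σ m'
  refine ⟨σ m', ?_⟩
  have e : (fun j => ind (U (σ (m'.succAbove j)))) = fun j => ind (U ((σ m').succAbove (τ j))) := by
    funext j; rw [hτ j]
  rw [e, sahiE_ind_comp_perm (bernoulliWeight p) τ (fun j => U ((σ m').succAbove j))] at hm'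
  exact hm'

/-- **(EQ-(k+2)) ⇒ (EQ-(k+3)) on the principal stratum, cylinder in any slot**: GIVEN `MasterFamilyEqIff (k+2)`, for `p`
interior and `k + 3` increasing events one of which is a cylinder `{ω | S ⊆ ω}`, `E_{k+3}(μ_p; 1_U) = 0 ↔ U ∈ Z_{k+3}`.
[this work] -/
theorem sahiE_ind_eq_zero_iff_of_cylinder {k : ℕ} (hE : MasterFamilyEqIff (k + 2)) (p : ι → unitInterval)
    (hp : ∀ e, (p e : ℝ) ∈ Set.Ioo (0 : ℝ) 1) (U : Fin (k + 3) → Set (Set ι)) (hU : ∀ j, IsUpperSet (U j))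
    (m₀ : Fin (k + 3)) (S : Set ι) (hm₀ : U m₀ = {ω : Set ι | S ⊆ ω}) :
    sahiE (bernoulliWeight p) (k + 3) (fun j => ind (U j)) = 0 ↔ SuppZeroFlag (k + 3) U := by
  have hN : MasterFamilyNonneg (k + 2) := masterFamilyNonneg_of_masterFamilyEqIff hE
  refine ⟨fun h => ?_, fun h => masterFamilyEqIff_mpr (k + 3) ι p U h⟩
  obtain ⟨m, hm⟩ := sahiE_ind_cylinder_heredity' hN p hp U hU m₀ S hm₀ h
  have hZ : SuppZeroFlag (k + 2) (fun j => U (m.succAbove j)) := (hE ι p hp _ fun j => hU _).1 hm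
  exact (masterFamily_step hN hE p hp U hU m hZ).2.1 h

/-- Unconditionally at order 3, cylinder in any slot: `E_3 = 0 ↔ Z_3`. [this work] -/
theorem sahiE_three_ind_eq_zero_iff_of_cylinder' (p : ι → unitInterval) (hp : ∀ e, (p e : ℝ) ∈ Set.Ioo (0 : ℝ) 1)
    (U : Fin 3 → Set (Set ι)) (hU : ∀ j, IsUpperSet (U j)) (m₀ : Fin 3) (S : Set ι)
    (hm₀ : U m₀ = {ω : Set ι | S ⊆ ω}) :
    sahiE (bernoulliWeight p) 3 (fun j => ind (U j)) = 0 ↔ SuppZeroFlag 3 U :=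
  sahiE_ind_eq_zero_iff_of_cylinder masterFamilyEqIff_two p hp U hU m₀ S hm₀

/-- At order 4, conditionally on `MasterFamilyEqIff 3`, cylinder in any slot: `E_4 = 0 ↔ Z_4`. [this work] -/
theorem sahiE_four_ind_eq_zero_iff_of_cylinder (hE : MasterFamilyEqIff 3) (p : ι → unitInterval)
    (hp : ∀ e, (p e : ℝ) ∈ Set.Ioo (0 : ℝ) 1) (U : Fin 4 → Set (Set ι)) (hU : ∀ j, IsUpperSet (U j)) (m₀ : Fin 4)
    (S : Set ι) (hm₀ : U m₀ = {ω : Set ι | S ⊆ ω}) :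
    sahiE (bernoulliWeight p) 4 (fun j => ind (U j)) = 0 ↔ SuppZeroFlag 4 U :=
  sahiE_ind_eq_zero_iff_of_cylinder hE p hp U hU m₀ S hm₀

end Events

end Summit.CriticalPhenomena.PercolationContinuityZ3.Theorems
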